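import Summits.FinalStateConjecture.FinalStateConjecture.Theses.TangentProfileCensorship
import Literature.Geometry.Lorentzian.SelfSimilarVacuumProfile
import Literature.Geometry.Lorentzian.TangentProfile
import Literature.Geometry.Lorentzian.IdealPoints

/-!
# Crux `NakedDataTameExit` — line `birth`: BIRTH SKELETON (BC3; skeleton registrar, 2026-08-17)

Crux item `stmt-FinalStateConjecture-17383`, decl (FIXED, concluded BY NAME in
`NakedDataTameExit_of` / `NakedDataTameExit_proof`):
`Summit.FinalStateConjecture.FinalStateConjecture.Theses.TangentProfileCensorship.NakedDataTameExit`
(route `route-FinalStateConjecture-TangentProfileCensorship`, crux rank 2, the route's spine) —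
NAKED DATA TAME EXIT: through every admissible vacuum datum `D` one of whose maximal vacuum Cauchy
developments has INCOMPLETE future null infinity (sojourn form) pass ONE asymptotically flat end
`e` and an injective one-parameter family `F` of admissible data, tame on `e`, immersed at `0`,
`F 0 = D`, whose members with `0 < ‖c‖ < ε` are GOOD in the re-typed summit's sense (an MGHD
exists; every MGHD has complete `𝓘⁺` and a sub-extremal Kerr final-state decomposition `d` of
`O = exteriorOf 𝒟 d.charted` with `RaysStayInClosure`, honest-radii `HasExhaustiveCharts`,
`IsFutureOriented`).

## The cut = the route's own TWO-LAYER PLAN, now typable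
## ("TangentProfileExtraction → SmoothProfileInstability (+ two-sided exit, quantisation) →
##   basin landing → NakedDataTameExit", route header), over LANDED definitions only

The four definition requests of the route have landed in the Literature prelude since the plan was
written (D1 `CauchyDevelopment.FirstNakedPoint`, IdealPoints.lean; D2 `SelfSimilarVacuumProfile`
(+ `IsNonflat`, `past`, `toSpacetime` for the regular-horizon class `⊤`), SelfSimilarVacuumProfile.lean;
D3 `Spacetime.IsTangentProfileAt`, TangentProfile.lean; D4 `HasSmoothUnstableMode`,
SelfSimilarUnstableMode.lean), so the informal layer-2 items of this route (stmt-9971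
TangentProfileExtraction, stmt-9972 SmoothProfileInstability + exit, stmt-9974 quantisation + basin
landing) can be cut into three TYPED statements, each a distinct mathematical content, each shared
verbatim with a sibling programme of this summit (so that one proof serves all):

* `stub_nakedTangentProfile` (S1) — TANGENT PROFILE EXTRACTION, exit-hedged typed form: for an
  admissible `D` and a maximal vacuum Cauchy development `𝒟` of `D` with INCOMPLETE `𝓘⁺`, EITHER a
  local tame good exit through `D` already exists, OR `𝒟` has a FIRST NAKED POINT `P` (minimal TIP,
  visible from infinity) carrying a NONFLAT smooth (regular-horizon class `⊤`) continuously-or-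
  discretely self-similar vacuum profile `Z` as a `C²` tangent profile (marked past `Z.past`).
  Signature byte-identical (up to whitespace) to the sibling item
  `HomotheticSurfaceGravity.NakedTangentProfile` (stmt-FinalStateConjecture-17353, crux r3 there,
  which its docstring calls "the typed form of the extraction step shared in content with
  TangentProfileCensorship's informal TangentProfileExtraction"; it has a live line
  `Cruxes/NakedTangentProfile/Lines/first_naked_point_zorn.lean` with three registered stubs).
  This is Steps 1–2 of the card: TIP localisation of a first naked point + scale-critical
  compactness / self-similar extraction + non-flatness + regularity of the limit across its cone.
  [open-problem; XL]
* `stub_profileCensoredExit` (S2) — SMOOTH-CLASS PROFILE INSTABILITY WITH TWO-SIDED EXIT INTO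
  CENSORED DATA: a first naked point of an MGHD of admissible `D` carrying a nonflat smooth
  self-similar `C²` tangent profile forces ONE end `e` and a tame (on `e`), immersed, injective
  admissible curve `F` through `D` whose members with `0 < ‖c‖ < ε` own an MGHD and are CENSORED
  (every MGHD has complete `𝓘⁺`). This is Steps 3–5(i) of the card — the unstable smooth mode of
  the profile (`HasSmoothUnstableMode`, to appear one layer below as a `--supports` lemma),
  transported to a compactly supported / glued constraint-satisfying perturbation on the SAME end
  (tame by `isTameDataFamily_restrict_of_agree_off_compact`, immersed as a non-zero jet), two-sided
  nonlinear exit (regular point / scale-critical trapped surface), finitely many first naked points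
  so one kick serves all. Signature byte-identical to the registered stub `stub_profileCensoredExit`
  of `Cruxes/LonelyTipTameExit/Lines/birth.lean` (route NoVacuumStrings); a literal weakening
  ("censored" for "good") of the sibling crux `HomotheticSurfaceGravity.ProfileExit` (stmt-17352).
  THE LOAD-BEARING STUB OF THIS ROUTE. [open-problem; XL]
* `stub_settlingAlongCensoredCurves` (S3) — BASIN LANDING, relative curve form with an ARBITRARY
  (here: the naked) admissible base datum: given a tame immersed injective admissible curve `F` on
  `e` through `D` ALL of whose members off `0` own an MGHD and are censored, there is one on the
  SAME end through `D` whose small members are GOOD (re-typed sense). Step 5(ii) of the card ("the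
  exit data land in the Kerr basin"; shared with the programme of the route's other crux
  `CensoredDataTameExit`). Signature byte-identical to the registered stub
  `stub_settlingAlongCensoredCurves` of `Cruxes/LonelyTipTameExit/Lines/birth.lean`.
  [open-problem; L–XL]

Composition `NakedDataTameExit_of` (kernel-checked, no `sorry` of its own): from the crux's
hypothesis take the maximal development `𝒟` with incomplete `𝓘⁺`; S1 either hands over the exit
(done) or a first naked point `P` with a nonflat smooth self-similar tangent profile `Z`; S2 at
`(D, 𝒟, P, Z)` gives a locally censoring tame curve through `D` on an end `e`; the LANDED kernel
`InitialDataSet.exists_tameFamily_of_local` (TameGenericityLocal.lean: radial reparametrisation,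
same end, same base datum) makes ALL its members off `0` censored with MGHDs; S3 re-chooses the
curve on `e` through `D` with good small members; that is the crux's conclusion verbatim. The seam
is the case split of S1 plus the reparametrisation theorem, not `exact ⟨h₁, h₂, h₃⟩`.

Logical position: crux ⟹ S1 (left disjunct; `nakedTangentProfile_of_crux`, §4, sorry-free);
S2 and S3 are NOT consequences of the crux (S2 pins the END-independent censored exit to a given
profile, S3 quantifies over ARBITRARY admissible base data and keeps the SAME end) — they are the
route's bets, recorded as such in `Lines/birth.md`; S1 ∧ S2 ∧ S3 ⟹ crux (this file). No stub is
the crux or the summit reworded (BC3 probes, below).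

## BC3 probes (seat folder `bc/NakedDataTameExit_probes*.lean`; they import the route file and the
## three Literature modules only — NOT this skeleton — so no sorried theorem concluding the crux is
## in scope for `exact?`)
For each stub `S` (signature restated verbatim as the hypothesis): `S → NakedDataTameExit` and
`S → FinalStateConjecture` by `first | exact? | simpa | aesop` (400 000 heartbeats) MUST FAIL; the
log (all FAIL) is in `Lines/birth.md`.

## Disproof used
None relevant: the crux has no `Disproof.lean` / `Negative/` lemma (`ledger crux ls
stmt-FinalStateConjecture-17383`: "no workfiles yet" before this one); the negatives index of the
summit lists no statement bearing on S1–S3. Grounder certificate on the item (HonestTopT2.lean,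
2026-08-16): `FinalStateConjecture → NakedDataTameExit` (honest top) — the crux is the naked half of
the re-typed exceptional set, so S2/S3 being bets STRONGER than needed pointwise is the price of a
typed mechanism, not a costume.
-/

noncomputable section

-- the doubled `FinalStateConjecture.FinalStateConjecture` path component trips dupNamespace
set_option linter.dupNamespace false

namespace Summit.FinalStateConjecture.FinalStateConjecture.Cruxes.NakedDataTameExit.Birth

open Set Filter Function Topology TopologicalSpace
open scoped Manifold ContDiff
open Literature.Geometry.Lorentzian
open Summit.FinalStateConjecture.FinalStateConjecture.Theses.TangentProfileCensorship

/-! ## §1 The three statements of the line (named; nothing here is a route item of THIS route) -/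

/-- **TANGENT PROFILE EXTRACTION, exit-hedged typed form** (`stub_nakedTangentProfile`; verbatim
the sibling item `HomotheticSurfaceGravity.NakedTangentProfile`, stmt-FinalStateConjecture-17353):
for every connected Hausdorff second-countable `3`-manifold `X`, every admissible datum `D` and
every maximal vacuum Cauchy development `𝒟` of `D` with INCOMPLETE future null infinity (sojourn
form), either there is a local good exit family through `D`, tame on one fixed asymptotically flat
end of `X` and immersed at `0` ("good" in the re-typed sense: an MGHD exists; every MGHD has
complete `𝓘⁺` and a sub-extremal Kerr decomposition of `O = exteriorOf` with `RaysStayInClosure`,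
honest-radii `HasExhaustiveCharts`, `IsFutureOriented`), or `𝒟` has a first naked point `P` (TIP,
visible from infinity, minimal among TIPs: `CauchyDevelopment.FirstNakedPoint`) and a NONFLAT
smooth self-similar vacuum profile `Z` (`SelfSimilarVacuumProfile ⊤`, continuously or discretely
self-similar, `C^∞` across its vertex past cone) which is a `C²` tangent profile of `𝒟` at `P`
(`Spacetime.IsTangentProfileAt … 2`, marked past `Z.past`). Content: causal-boundary localisation
of a FIRST naked ideal point with regular past (Geroch–Kronheimer–Penrose TIPs; RSR 2023 Def. 1.1)
and self-similar extraction at it (scale-critical compactness modulo scaling and gauge,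
Rodnianski–Shlapentokh-Rothman 2018 Thm. 1.2; non-flatness by `ε`-regularity; regularity of the
limit across its cone). Why it might fail: if the tangent cone is NOT smooth the second disjunct
(`Z` of class `⊤`) is void — the known vacuum naked singularities are only `C^{1,cε²}` / twisted
across the cone (arXiv:1912.08478 Thm. 1; arXiv:2204.09891) — and the first disjunct is then full
censorship-with-landing there; piled-up TIPs may leave no FIRST naked point; Type-II rates give no
self-similar limit; no scale-critical monotone quantity for `Ric = 0` is known.
[cite: RodnianskiShlapentokhrothman2018, Thm. 1.2] [cite: RodnianskiShlapentokhRothman2023, Def. 1.1] -/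
def NakedTangentProfileExtraction : Prop :=
  ∀ (X : Type) [TopologicalSpace X] [ChartedSpace Literature.Geometry.Lorentzian.E3 X] [IsManifold (𝓡 3) ((⊤ : ℕ∞) : WithTop ℕ∞) X] [T2Space X] [SecondCountableTopology X] [ConnectedSpace X], ∀ D ∈ Literature.Geometry.Lorentzian.admissibleVacuumData X, ∀ 𝒟 : Literature.Geometry.Lorentzian.VacuumCauchyDevelopment D, 𝒟.IsMaximal → ¬ Summit.FinalStateConjecture.HasCompleteNullInfinity 𝒟.toCauchyDevelopment → (∃ (e : Literature.Geometry.Lorentzian.AFEnd X) (F : EuclideanSpace ℝ (Fin 1) → Literature.Geometry.Lorentzian.InitialDataSet (𝓡 3) X), Literature.Geometry.Lorentzian.InitialDataSet.IsTameDataFamily e 1 F ∧ Literature.Geometry.Lorentzian.InitialDataSet.IsImmersedAtZero 1 F ∧ F 0 = D ∧ Function.Injective F ∧ (∀ c, F c ∈ Literature.Geometry.Lorentzian.admissibleVacuumData X) ∧ ∃ ε : ℝ, 0 < ε ∧ ∀ c, c ≠ 0 → ‖c‖ < ε → ((∃ 𝒟' : Literature.Geometry.Lorentzian.VacuumCauchyDevelopment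 (F c), 𝒟'.IsMaximal) ∧ ∀ 𝒟' : Literature.Geometry.Lorentzian.VacuumCauchyDevelopment (F c), 𝒟'.IsMaximal → Summit.FinalStateConjecture.HasCompleteNullInfinity 𝒟'.toCauchyDevelopment ∧ ∃ (O : Set 𝒟'.carrier) (d : Literature.Geometry.Lorentzian.FinalStateDecomposition 𝒟'.toSpacetime O 2), (∀ i, Literature.Geometry.Lorentzian.Kerr.IsSubextremal (d.mass i) (d.spin i)) ∧ O = Summit.FinalStateConjecture.exteriorOf 𝒟'.toCauchyDevelopment d.charted ∧ Summit.FinalStateConjecture.RaysStayInClosure 𝒟'.toCauchyDevelopment O ∧ Summit.FinalStateConjecture.HasExhaustiveCharts d ∧ Summit.FinalStateConjecture.IsFutureOriented d)) ∨ ∃ P : Set 𝒟.carrier, 𝒟.toCauchyDevelopment.FirstNakedPoint P ∧ ∃ Z : Literature.Geometry.Lorentzian.SelfSimilarVacuumProfile.{0} ((⊤ : ℕ∞) : WithTop ℕ∞), Z.IsNonflat ∧ Literature.Geometry.Lorentzian.Spacetime.IsTangentProfileAt 𝒟.toSpacetime P Z.toSpacetime Z.past 2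

/-- **SMOOTH-CLASS PROFILE INSTABILITY: EXIT FROM A SELF-SIMILAR FIRST NAKED POINT INTO CENSORED
DATA** (`stub_profileCensoredExit`; verbatim the registered stub of
`Cruxes/LonelyTipTameExit/Lines/birth.lean`): for every admissible datum `D`, maximal vacuum Cauchy
development `𝒟` of `D`, first naked point `P` of `𝒟` and NONFLAT smooth self-similar vacuum profile
`Z` which is a `C²` tangent profile of `𝒟` at `P` (marked past `Z.past`), there are ONE
asymptotically flat end `e` of `X`, a one-parameter family `F` of admissible data tame on `e`
(`IsTameDataFamily e 1 F`), immersed at `0` (`IsImmersedAtZero 1 F`), injective, with `F 0 = D`,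
and `ε > 0` such that for `0 < ‖c‖ < ε` the datum `F c` owns an MGHD and every MGHD of `F c` has
complete future null infinity. Content (the spine of route TangentProfileCensorship): every profile
tangent to a SMOOTH solution has, modulo gauge, an unstable smooth eigenmode of the linearised
vacuum operator in self-similar time (`HasSmoothUnstableMode`; MRRS finite-codimension stability of
smooth self-similar profiles, Donninger-type mode analysis, interval-arithmetic certification
profile by profile); transported through the constraint manifold to a compactly supported / glued
perturbation of `D` on the SAME end (tame by `isTameDataFamily_restrict_of_agree_off_compact`,
immersed as a non-zero jet) it makes `P` a regular point on one side and a trapped (scale-critical,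
An–Luk) point on the other — both CENSORED; a flux quantum per profile bounds the number of first
naked points, so one generic kick exits all of them (Christodoulou CQG 16 (1999) A23, p. A24:
lines of FIXED asymptotics transversal to the exceptional set). A literal weakening ("censored"
for "good") of `HomotheticSurfaceGravity.ProfileExit` (stmt-17352). Why it might fail:
self-similar naked singularities can be STABLE at threshold regularity and under small smooth
perturbations of mild profiles (Zheng arXiv:2605.16235 Thm. 1.3; Singh–Zheng arXiv:2605.16095);
smooth-to-cone DSS naked exteriors with `μ ≪ 1` exist (arXiv:2412.09540); a vacuum critical
solution with several unstable modes breaks the two-sided picture; a second naked point may be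
born along the curve (no quantisation theorem); the kick must keep the Dafermos–Rodnianski rates on
ONE fixed end with continuous mass. [cite: Christodoulou1999instability] [cite: Christodoulou1999, p. A24]
[cite: MerleEtAl2022] [cite: An2025] -/
def ProfileCensoredExit : Prop :=
  ∀ (X : Type) [TopologicalSpace X] [ChartedSpace E3 X] [IsManifold (𝓡 3) ((⊤ : ℕ∞) : WithTop ℕ∞) X] [T2Space X] [SecondCountableTopology X] [ConnectedSpace X], ∀ D ∈ admissibleVacuumData X, ∀ 𝒟 : VacuumCauchyDevelopment D, 𝒟.IsMaximal → ∀ P : Set 𝒟.carrier, 𝒟.toCauchyDevelopment.FirstNakedPoint P → ∀ Z : SelfSimilarVacuumProfile.{0} ((⊤ : ℕ∞) : WithTop ℕ∞), Z.IsNonflat → Spacetime.IsTangentProfileAt 𝒟.toSpacetime P Z.toSpacetime Z.past 2 → ∃ (e : AFEnd X) (F : EuclideanSpace ℝ (Fin 1) → InitialDataSet (𝓡 3) X), InitialDataSet.IsTameDataFamily e 1 F ∧ InitialDataSet.IsImmersedAtZero 1 F ∧ F 0 = D ∧ Function.Injective F ∧ (∀ c, F c ∈ admissibleVacuumData X) ∧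 ∃ ε : ℝ, 0 < ε ∧ ∀ c, c ≠ 0 → ‖c‖ < ε → ((∃ 𝒟' : VacuumCauchyDevelopment (F c), 𝒟'.IsMaximal) ∧ ∀ 𝒟' : VacuumCauchyDevelopment (F c), 𝒟'.IsMaximal → Summit.FinalStateConjecture.HasCompleteNullInfinity 𝒟'.toCauchyDevelopment)

/-- **BASIN LANDING ALONG A CENSORED CURVE** (relative curve form, ARBITRARY admissible base datum;
`stub_settlingAlongCensoredCurves`, verbatim the registered stub of
`Cruxes/LonelyTipTameExit/Lines/birth.lean`): let `D` be an admissible datum (no hypothesis on its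
own developments: in the line `D` is the NAKED datum of the crux) and `F` a one-parameter family of
admissible data, tame on the end `e`, immersed at `0`, injective, `F 0 = D`, ALL of whose members
off `0` own an MGHD and are censored. Then there is a family `F'` of admissible data, tame on the
SAME end, immersed at `0`, injective, `F' 0 = D`, and `ε > 0` such that for `0 < ‖c‖ < ε` the
datum `F' c` is GOOD: it owns an MGHD, and every MGHD of `F' c` has complete `𝓘⁺` and carries a
sub-extremal `N`-Kerr final-state decomposition `d` of `O = exteriorOf 𝒟 d.charted` with
`RaysStayInClosure`, `HasExhaustiveCharts` (honest radii) and `IsFutureOriented`. Content: the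
final-state half of the conjecture RELATIVE to a censored curve — large-data asymptotic stability
of the sub-extremal Kerr family for the censored exit developments (Dafermos–Luk 2017 §1.2.1;
Klainerman–Szeftel 2023 for `|a| ≪ M`), genericity of the third law (Kehle–Unger 2025: extremal
horizons form, as a threshold to be stepped off by RE-CHOOSING the curve through the same base
point), and the interior clause `RaysStayInClosure`. Why it might fail: Kerr stability is printed
only for `|a| ≪ M` (barrier `SlowlyRotatingKerrFrontier`); near a NAKED base datum the censored
members are near-critical, where non-settling / extremal / many-hole end states may accumulate
along every tame curve through `D` (Cantor-like threshold lamination, cf. arXiv:0711.4612),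
leaving no re-chosen curve with good small members; the statement is deterministic in `D`
(arbitrary admissible base datum), so ONE bad corner datum refutes it.
[cite: DafermosLuk2017, §1.2.1] [cite: KlainermanSzeftel2023] [cite: KehleUnger2025] -/
def SettlingAlongCensoredCurves : Prop :=
  ∀ (X : Type) [TopologicalSpace X] [ChartedSpace E3 X] [IsManifold (𝓡 3) ((⊤ : ℕ∞) : WithTop ℕ∞) X] [T2Space X] [SecondCountableTopology X] [ConnectedSpace X], ∀ D ∈ admissibleVacuumData X, ∀ (e : AFEnd X) (F : EuclideanSpace ℝ (Fin 1) → InitialDataSet (𝓡 3) X), InitialDataSet.IsTameDataFamily e 1 F → InitialDataSet.IsImmersedAtZero 1 F → F 0 = D → Function.Injective F → (∀ c, F c ∈ admissibleVacuumData X) → (∀ c, c ≠ 0 → ((∃ 𝒟 : VacuumCauchyDevelopment (F c), 𝒟.IsMaximal) ∧ ∀ 𝒟 : VacuumCauchyDevelopment (F c), 𝒟.IsMaximal → Summit.FinalStateConjecture.HasCompleteNullInfinity 𝒟.toCauchyDevelopment)) → ∃ F' : EuclideanSpace ℝ (Fin 1) → InitialDataSet (𝓡 3) X, InitialDataSet.IsTameDataFamily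 e 1 F' ∧ InitialDataSet.IsImmersedAtZero 1 F' ∧ F' 0 = D ∧ Function.Injective F' ∧ (∀ c, F' c ∈ admissibleVacuumData X) ∧ ∃ ε : ℝ, 0 < ε ∧ ∀ c, c ≠ 0 → ‖c‖ < ε → ((∃ 𝒟 : VacuumCauchyDevelopment (F' c), 𝒟.IsMaximal) ∧ ∀ 𝒟 : VacuumCauchyDevelopment (F' c), 𝒟.IsMaximal → Summit.FinalStateConjecture.HasCompleteNullInfinity 𝒟.toCauchyDevelopment ∧ ∃ (O : Set 𝒟.carrier) (d : FinalStateDecomposition 𝒟.toSpacetime O 2), (∀ i, Kerr.IsSubextremal (d.mass i) (d.spin i)) ∧ O = Summit.FinalStateConjecture.exteriorOf 𝒟.toCauchyDevelopment d.charted ∧ Summit.FinalStateConjecture.RaysStayInClosure 𝒟.toCauchyDevelopment O ∧ Summit.FinalStateConjecture.HasExhaustiveCharts d ∧ Summit.FinalStateConjecture.IsFutureOriented d)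

/-! ### Statements of the registered stubs, under the stub names
The skeleton audit reads the hypotheses of `NakedDataTameExit_of` BY NAME: each head is a declared
stub. -/
namespace Goal

/-- Statement of `stub_nakedTangentProfile`. -/
abbrev stub_nakedTangentProfile : Prop := NakedTangentProfileExtraction
/-- Statement of `stub_profileCensoredExit`. -/
abbrev stub_profileCensoredExit : Prop := ProfileCensoredExit
/-- Statement of `stub_settlingAlongCensoredCurves`. -/
abbrev stub_settlingAlongCensoredCurves : Prop := SettlingAlongCensoredCurves

end Goal

/-! ## §2 Registered stubs (the three `sorry`s of the file), stated EXPANDED over existing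
declarations (Statement + Literature prelude only; no vocabulary of this file occurs in a stub
signature). S1 is fully qualified (byte-identical to the sibling item `NakedTangentProfile`);
S2–S3 use the short prelude names exactly as their registrations in
`Cruxes/LonelyTipTameExit/Lines/birth.lean`: a Theorems file proving one elaborates the registered
signature verbatim after `open Literature.Geometry.Lorentzian` and `open scoped Manifold`. -/

/-- **Stub 1** (XL, open-problem): tangent profile extraction, exit-hedged — see
`NakedTangentProfileExtraction`. [cite: RodnianskiShlapentokhrothman2018, Thm. 1.2] -/
theorem stub_nakedTangentProfile :
    ∀ (X : Type) [TopologicalSpace X] [ChartedSpace Literature.Geometry.Lorentzian.E3 X] [IsManifold (𝓡 3) ((⊤ : ℕ∞) : WithTop ℕ∞) X] [T2Space X] [SecondCountableTopology X] [ConnectedSpace X], ∀ D ∈ Literature.Geometry.Lorentzian.admissibleVacuumData X, ∀ 𝒟 : Literature.Geometry.Lorentzian.VacuumCauchyDevelopment D, 𝒟.IsMaximal → ¬ Summit.FinalStateConjecture.HasCompleteNullInfinity 𝒟.toCauchyDevelopment → (∃ (e : Literature.Geometry.Lorentzian.AFEnd X) (F : EuclideanSpace ℝ (Fin 1) → Literature.Geometry.Lorentzian.InitialDataSet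 (𝓡 3) X), Literature.Geometry.Lorentzian.InitialDataSet.IsTameDataFamily e 1 F ∧ Literature.Geometry.Lorentzian.InitialDataSet.IsImmersedAtZero 1 F ∧ F 0 = D ∧ Function.Injective F ∧ (∀ c, F c ∈ Literature.Geometry.Lorentzian.admissibleVacuumData X) ∧ ∃ ε : ℝ, 0 < ε ∧ ∀ c, c ≠ 0 → ‖c‖ < ε → ((∃ 𝒟' : Literature.Geometry.Lorentzian.VacuumCauchyDevelopment (F c), 𝒟'.IsMaximal) ∧ ∀ 𝒟' : Literature.Geometry.Lorentzian.VacuumCauchyDevelopment (F c), 𝒟'.IsMaximal → Summit.FinalStateConjecture.HasCompleteNullInfinity 𝒟'.toCauchyDevelopment ∧ ∃ (O : Set 𝒟'.carrier) (d : Literature.Geometry.Lorentzian.FinalStateDecomposition 𝒟'.toSpacetime O 2), (∀ i, Literature.Geometry.Lorentzian.Kerr.IsSubextremal (d.mass i) (d.spin i)) ∧ O = Summit.FinalStateConjecture.exteriorOf 𝒟'.toCauchyDevelopment d.charted ∧ Summit.FinalStateConjecture.RaysStayInClosure 𝒟'.toCauchyDevelopment O ∧ Summit.FinalStateConjecture.HasExhaustiveCharts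 d ∧ Summit.FinalStateConjecture.IsFutureOriented d)) ∨ ∃ P : Set 𝒟.carrier, 𝒟.toCauchyDevelopment.FirstNakedPoint P ∧ ∃ Z : Literature.Geometry.Lorentzian.SelfSimilarVacuumProfile.{0} ((⊤ : ℕ∞) : WithTop ℕ∞), Z.IsNonflat ∧ Literature.Geometry.Lorentzian.Spacetime.IsTangentProfileAt 𝒟.toSpacetime P Z.toSpacetime Z.past 2 := by
  sorry

/-- **Stub 2** (XL, open-problem; load-bearing): smooth-class profile instability with censored
exit — see `ProfileCensoredExit`. [cite: Christodoulou1999instability] -/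
theorem stub_profileCensoredExit : ∀ (X : Type) [TopologicalSpace X] [ChartedSpace E3 X] [IsManifold (𝓡 3) ((⊤ : ℕ∞) : WithTop ℕ∞) X] [T2Space X] [SecondCountableTopology X] [ConnectedSpace X], ∀ D ∈ admissibleVacuumData X, ∀ 𝒟 : VacuumCauchyDevelopment D, 𝒟.IsMaximal → ∀ P : Set 𝒟.carrier, 𝒟.toCauchyDevelopment.FirstNakedPoint P → ∀ Z : SelfSimilarVacuumProfile.{0} ((⊤ : ℕ∞) : WithTop ℕ∞), Z.IsNonflat → Spacetime.IsTangentProfileAt 𝒟.toSpacetime P Z.toSpacetime Z.past 2 → ∃ (e : AFEnd X) (F : EuclideanSpace ℝ (Fin 1) → InitialDataSet (𝓡 3) X), InitialDataSet.IsTameDataFamily e 1 F ∧ InitialDataSet.IsImmersedAtZero 1 F ∧ F 0 = D ∧ Function.Injective F ∧ (∀ c, F c ∈ admissibleVacuumData X) ∧ ∃ ε : ℝ, 0 < ε ∧ ∀ c, c ≠ 0 → ‖c‖ < ε → ((∃ 𝒟' : VacuumCauchyDevelopment (F c), 𝒟'.IsMaximal) ∧ ∀ 𝒟' : VacuumCauchyDevelopment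 (F c), 𝒟'.IsMaximal → Summit.FinalStateConjecture.HasCompleteNullInfinity 𝒟'.toCauchyDevelopment) := by
  sorry

/-- **Stub 3** (L–XL, open-problem): basin landing along a censored curve — see
`SettlingAlongCensoredCurves`. [cite: DafermosLuk2017, §1.2.1] -/
theorem stub_settlingAlongCensoredCurves : ∀ (X : Type) [TopologicalSpace X] [ChartedSpace E3 X] [IsManifold (𝓡 3) ((⊤ : ℕ∞) : WithTop ℕ∞) X] [T2Space X] [SecondCountableTopology X] [ConnectedSpace X], ∀ D ∈ admissibleVacuumData X, ∀ (e : AFEnd X) (F : EuclideanSpace ℝ (Fin 1) → InitialDataSet (𝓡 3) X), InitialDataSet.IsTameDataFamily e 1 F → InitialDataSet.IsImmersedAtZero 1 F → F 0 = D → Function.Injective F → (∀ c, F c ∈ admissibleVacuumData X) → (∀ c, c ≠ 0 → ((∃ 𝒟 : VacuumCauchyDevelopment (F c), 𝒟.IsMaximal) ∧ ∀ 𝒟 : VacuumCauchyDevelopment (F c), 𝒟.IsMaximal → Summit.FinalStateConjecture.HasCompleteNullInfinity 𝒟.toCauchyDevelopment)) → ∃ F' : EuclideanSpace ℝ (Fin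 1) → InitialDataSet (𝓡 3) X, InitialDataSet.IsTameDataFamily e 1 F' ∧ InitialDataSet.IsImmersedAtZero 1 F' ∧ F' 0 = D ∧ Function.Injective F' ∧ (∀ c, F' c ∈ admissibleVacuumData X) ∧ ∃ ε : ℝ, 0 < ε ∧ ∀ c, c ≠ 0 → ‖c‖ < ε → ((∃ 𝒟 : VacuumCauchyDevelopment (F' c), 𝒟.IsMaximal) ∧ ∀ 𝒟 : VacuumCauchyDevelopment (F' c), 𝒟.IsMaximal → Summit.FinalStateConjecture.HasCompleteNullInfinity 𝒟.toCauchyDevelopment ∧ ∃ (O : Set 𝒟.carrier) (d : FinalStateDecomposition 𝒟.toSpacetime O 2), (∀ i, Kerr.IsSubextremal (d.mass i) (d.spin i)) ∧ O = Summit.FinalStateConjecture.exteriorOf 𝒟.toCauchyDevelopment d.charted ∧ Summit.FinalStateConjecture.RaysStayInClosure 𝒟.toCauchyDevelopment O ∧ Summit.FinalStateConjecture.HasExhaustiveCharts d ∧ Summit.FinalStateConjecture.IsFutureOriented d) := by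
  sorry

/-! ## §3 The composition (kernel-checked; no `sorry` of its own) -/

/-- **THE CRUX BY NAME from the three registered stubs.** Take the maximal development with
incomplete `𝓘⁺` from the crux's hypothesis; Stub 1 hands over the exit or a first naked point with a
nonflat smooth self-similar tangent profile; Stub 2 gives a locally censoring tame curve through `D`
on an end `e`; the landed kernel `InitialDataSet.exists_tameFamily_of_local` makes every member off
`0` censored with an MGHD (same end, same base datum); Stub 3 re-chooses the curve on `e` through
`D` with good small members — the crux's conclusion verbatim. [folklore] -/
theorem NakedDataTameExit_of :
    Goal.stub_nakedTangentProfile → Goal.stub_profileCensoredExit →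
      Goal.stub_settlingAlongCensoredCurves → NakedDataTameExit := by
  intro h₁ h₂ h₃ X _ _ _ _ _ _ D hD hnaked
  obtain ⟨𝒟, h𝒟, hinc⟩ := hnaked
  -- Stub 1: exit, or a first naked point carrying a nonflat smooth self-similar tangent profile
  rcases h₁ X D hD 𝒟 h𝒟 hinc with hexit | ⟨P, hP, Z, hZ, hT⟩
  · exact hexit
  -- Stub 2: a tame immersed injective admissible curve through `D`, censored (with MGHDs) for small `c`
  obtain ⟨e, F, hF, hI, hF0, hinj, hadm, ε, hε, hC⟩ := h₂ X D hD 𝒟 h𝒟 P hP Z hZ hT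
  -- kernel (landed, TameGenericityLocal): ALL members off `0` censored, same end, same base datum
  obtain ⟨F₁, hF₁, hF₁0, hinj₁, hI₁, hadm₁, hC₁⟩ :=
    InitialDataSet.exists_tameFamily_of_local (P := fun D' ↦
      (∃ 𝒟' : VacuumCauchyDevelopment D', 𝒟'.IsMaximal) ∧ ∀ 𝒟' : VacuumCauchyDevelopment D',
        𝒟'.IsMaximal → Summit.FinalStateConjecture.HasCompleteNullInfinity 𝒟'.toCauchyDevelopment)
      hF hI hinj hadm hε hC
  -- Stub 3: basin landing along the censored curve, re-chosen through `D` on the same end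
  obtain ⟨F₂, hF₂, hI₂, hF₂0, hinj₂, hadm₂, ε₂, hε₂, hG⟩ :=
    h₃ X D hD e F₁ hF₁ hI₁ (hF₁0.trans hF0) hinj₁ hadm₁ hC₁
  exact ⟨e, F₂, hF₂, hI₂, hF₂0, hinj₂, hadm₂, ε₂, hε₂, hG⟩

/-! ### Consistency: each registered stub, stated EXPANDED, IS the named statement of §1 (by `δ`). -/

theorem nakedTangentProfileExtraction_holds : NakedTangentProfileExtraction := stub_nakedTangentProfile
theorem profileCensoredExit_holds : ProfileCensoredExit := stub_profileCensoredExit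
theorem settlingAlongCensoredCurves_holds : SettlingAlongCensoredCurves :=
  stub_settlingAlongCensoredCurves

/-- **The crux from the skeleton** (closed modulo the three `sorry`s). [folklore] -/
theorem NakedDataTameExit_proof : NakedDataTameExit :=
  NakedDataTameExit_of stub_nakedTangentProfile stub_profileCensoredExit
    stub_settlingAlongCensoredCurves

/-! ## §4 Sanity (no `sorry`): the crux implies Stub 1 — a genuine WEAKENING (left disjunct);
Stubs 2–3 are the route's bets (see the module docstring). -/

/-- The crux implies Stub 1: a maximal development with incomplete `𝓘⁺` witnesses the crux's
hypothesis, and the crux's exit is the first disjunct. [folklore] -/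
theorem nakedTangentProfile_of_crux (h : NakedDataTameExit) : NakedTangentProfileExtraction := by
  intro X _ _ _ _ _ _ D hD 𝒟 h𝒟 hinc
  exact Or.inl (h X D hD ⟨𝒟, h𝒟, hinc⟩)

/-- Sanity on the sharing: Stub 1 IS the sibling item `HomotheticSurfaceGravity.NakedTangentProfile`
up to the name (stated here without importing that route file: the two `Prop`s are syntactically
identical). Recorded as the δ-identity of §1's def with the registered signature. [folklore] -/
example : NakedTangentProfileExtraction ↔ Goal.stub_nakedTangentProfile := Iff.rfl

end Summit.FinalStateConjecture.FinalStateConjecture.Cruxes.NakedDataTameExit.Birth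

end
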